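import Summits.Ventures.PercRepro.MSTightHalvesExcess

/-!
# (M0) forces a tight half: `D(F₀) ∩ D(F₁) ⊆ Y` and excess one give `F₀` tight or `F₁` tight

Dossier proofs/MINE1-theoremS.md, Addendum 49 supplement 1. For a family `F` of excess one
(`|D(F)| = |F| + 1`) and an element `r` (`F₀ = part0 r F`, `F₁ = partr r F`, `X = diffsX r F`,
`Y = diffsY r F`), suppose neither half is tight. Then both halves have excess exactly one
(`card_diffs_part0_le_succ_of_excess_one`, `card_diffs_partr_le_succ_of_excess_one`), the refined
two-family bound leaves no room and `X = D(F₀) ∪ D(F₁)`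
(`diffsX_subset_of_excess_one_of_part0_not_tight`), so `|X| = |F₀| + |F₁| + 2 − |D(F₀) ∩ D(F₁)|`
and `|X| + |Y| = |F| + 1` give `|Y| + 1 = |D(F₀) ∩ D(F₁)|`. Hence the lane's census-true
statement (M0) «`D(F₀) ∩ D(F₁) ⊆ Y`» is impossible: **(M0) + excess one ⟹ a tight half**
(`tight_part0_or_tight_partr_of_M0`), at every direction — no tightness of the trace is needed.
Together with p479438 (`diffsY_subset_diffsX_of_tight_half_of_Rstar`: L1 + L2′ ⟹ (T)) this
replaces L1 by (M0) in the lane's reduction of Conjecture (T).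
-/

namespace PercRepro.MSTight

open Finset
open scoped FinsetFamily

variable {α : Type*} [DecidableEq α]

/-- **(M0) forces a tight half.** If `|D(F)| = |F| + 1` and `D(F₀) ∩ D(F₁) ⊆ Y`, then `F₀` or
`F₁` is tight. -/
theorem tight_part0_or_tight_partr_of_M0 {r : α} {F : Finset (Finset α)}
    (hex : (F \\ F).card = F.card + 1)
    (hM0 : (part0 r F \\ part0 r F) ∩ (partr r F \\ partr r F) ⊆ diffsY r F) :
    Tight (part0 r F) ∨ Tight (partr r F) := by
  by_contra hcon
  rw [not_or] at hcon
  obtain ⟨h0, h1⟩ := hcon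
  unfold Tight at h0 h1
  have hMS0 := Finset.card_le_card_diffs (part0 r F)
  have hMS1 := Finset.card_le_card_diffs (partr r F)
  have hH0 := card_diffs_part0_le_succ_of_excess_one (r := r) hex
  have hH1 := card_diffs_partr_le_succ_of_excess_one (r := r) hex
  have he0 : (part0 r F \\ part0 r F).card = (part0 r F).card + 1 := by omega
  have hXsub := diffsX_subset_of_excess_one_of_part0_not_tight hex he0
  have hXeq : diffsX r F = part0 r F \\ part0 r F ∪ partr r F \\ partr r F :=
    Finset.Subset.antisymm hXsub Finset.subset_union_left
  have hXY := card_diffs_eq_card_X_add_card_Y r F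
  have hF := card_eq_card_part0_add_card_partr r F
  have hui := Finset.card_union_add_card_inter (part0 r F \\ part0 r F)
    (partr r F \\ partr r F)
  have hM0c := Finset.card_le_card hM0
  rw [hXeq] at hXY
  omega

end PercRepro.MSTight
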